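import Mathlib
import HarnessLib
import Summits.CriticalPhenomena.PercolationContinuityZ3.Theorems.PercNearOneGluingNoHeavyLowerTailAntipodalInterfaceGluing

/-!
# The two forms of the fibrewise SPLIT inequality: correlation form `Σ_𝒩 α γ` versus counting form `A ≤ B`

Helper file for crux `stmt-CriticalPhenomena-4575` (`NoHeavyLowerTail`, route `PercNearOneGluingNoHeavy`),
new-inequality factory seat `prim-ineq-gen-1` (gen 9).  Everything here is PROVED; no route definition is touched.
Memo: `run/shared/lean/prim/prim-ineq-gen-1/THEOREM-SPLIT-REDUCTION.md` FACT 0 and `FINDING-15-…md` §1.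

The conjectured fibrewise ("antipodal") SPLIT inequality T2 is used in two equivalent dresses in the programme's
memos and Lean files:

* the COUNTING form `A ≤ B` with
  `A = #{Y : red(Y) joins a–v and b–c (two clusters, no cross), blue(Y) = Yᶜ joins none of the four}`,
  `B = #{Y : red(Y) joins a–v only, blue(Y) joins b–c only}` (FINDING-12 §7; all census numbers are `B − A`);
* the CORRELATION form `Σ_Y 1_𝒩(Y) α(Y) γ(Y) ≤ 0`, `α = [a ~_red v] − [a ~_blue v]`, `γ = [b ~_red c] − [b ~_blue c]`,
  `𝒩` = no monochromatic cross (the form proved across an interface in `…AntipodalInterfaceGluing.lean` and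
  `…AntipodalCutVertexGraph.lean`).

This file proves the bookkeeping identity behind "FACT 0" in complete generality: for ANY finite Boolean lattice
`2^ι`, any family `𝒩` invariant under the antipodal map `X ↦ Xᶜ`, and any two families `𝒜` ("a ~ v") and `ℬ`
("b ~ c"),

  `Σ_X 1_𝒩(X) (1_𝒜(X) − 1_𝒜(Xᶜ)) (1_ℬ(X) − 1_ℬ(Xᶜ)) = 2 (A − B)`,
  `A = #{X ∈ 𝒩 : X ∈ 𝒜, X ∈ ℬ, Xᶜ ∉ 𝒜, Xᶜ ∉ ℬ}`,  `B = #{X ∈ 𝒩 : X ∈ 𝒜, Xᶜ ∈ ℬ, Xᶜ ∉ 𝒜, X ∉ ℬ}`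

(`sum_pref_mul_pref_eq_two_mul`), so that `Σ_𝒩 α γ ≤ 0 ↔ A ≤ B` (`sum_pref_mul_pref_nonpos_iff`).  The proof is a
pointwise identity between `0/1` polynomials, `(p − p′)(q − q′) = E(p,p′,q,q′) + E(p′,p,q′,q)` with
`E = p q (1 − p′)(1 − q′) − p q′ (1 − p′)(1 − q)`, summed with the antipodal re-indexing
`AntipodalInterfaceGluing.sum_comp_compl`.  No up-set or graph structure is needed.  (This work, 2026-08-20.)
-/

namespace Summit.CriticalPhenomena.PercolationContinuityZ3.Theorems

namespace AntipodalSplitForms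

open Finset AntipodalInterfaceGluing

variable {ι : Type*} [DecidableEq ι] [Fintype ι]

omit [Fintype ι] in
/-- The `0/1` indicator of membership, as an integer. [this work] -/
theorem ind_mem_eq (𝒮 : Finset (Finset ι)) (X : Finset ι) :
    (if X ∈ 𝒮 then (1 : ℤ) else 0) = 0 ∨ (if X ∈ 𝒮 then (1 : ℤ) else 0) = 1 := by
  by_cases h : X ∈ 𝒮 <;> simp [h]

/-- The pointwise identity `(p − p′)(q − q′) = E(p,p′,q,q′) + E(p′,p,q′,q)` for `0/1` values, with
`E(p,p′,q,q′) = p q (1−p′)(1−q′) − p q′ (1−p′)(1−q)`. [this work] -/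
theorem pref_mul_pref_pointwise (p p' q q' : ℤ) (hp : p = 0 ∨ p = 1) (hp' : p' = 0 ∨ p' = 1)
    (hq : q = 0 ∨ q = 1) (hq' : q' = 0 ∨ q' = 1) :
    (p - p') * (q - q') =
      (p * q * (1 - p') * (1 - q') - p * q' * (1 - p') * (1 - q)) +
        (p' * q' * (1 - p) * (1 - q) - p' * q * (1 - p) * (1 - q')) := by
  rcases hp with rfl | rfl <;> rcases hp' with rfl | rfl <;> rcases hq with rfl | rfl <;>
    rcases hq' with rfl | rfl <;> norm_num

/-- A sum of `0/1`-valued indicator products over the whole lattice is the cardinality of the corresponding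
filter. [this work] -/
theorem sum_ind_prod_eq_card (𝒩 𝒜 ℬ 𝒞 𝒟 : Finset (Finset ι)) :
    ∑ X : Finset ι, (if X ∈ 𝒩 then (1 : ℤ) else 0) *
        ((if X ∈ 𝒜 then (1 : ℤ) else 0) * (if X ∈ ℬ then (1 : ℤ) else 0) *
          (1 - (if X ∈ 𝒞 then (1 : ℤ) else 0)) * (1 - (if X ∈ 𝒟 then (1 : ℤ) else 0))) =
      ((𝒩.filter (fun X => X ∈ 𝒜 ∧ X ∈ ℬ ∧ X ∉ 𝒞 ∧ X ∉ 𝒟)).card : ℤ) := by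
  rw [Finset.card_filter, Nat.cast_sum]
  rw [← Finset.sum_subset (Finset.subset_univ 𝒩) (fun X _ hX => by simp [hX])]
  refine Finset.sum_congr rfl fun X hX => ?_
  by_cases h1 : X ∈ 𝒜 <;> by_cases h2 : X ∈ ℬ <;> by_cases h3 : X ∈ 𝒞 <;> by_cases h4 : X ∈ 𝒟 <;>
    simp [hX, h1, h2, h3, h4]

/-- **Correlation form = counting form.**  For every antipodally invariant `𝒩 ⊆ 2^ι` and all `𝒜, ℬ ⊆ 2^ι`:
`Σ_X 1_𝒩(X) (1_𝒜(X) − 1_𝒜(Xᶜ)) (1_ℬ(X) − 1_ℬ(Xᶜ)) = 2 (A − B)` with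
`A = #{X ∈ 𝒩 : X ∈ 𝒜, X ∈ ℬ, Xᶜ ∉ 𝒜, Xᶜ ∉ ℬ}` and `B = #{X ∈ 𝒩 : X ∈ 𝒜, Xᶜ ∈ ℬ, Xᶜ ∉ 𝒜, X ∉ ℬ}`.
With `𝒜 = {a ~ v}`, `ℬ = {b ~ c}` (red graph of `X`), `𝒩` = no monochromatic cross, this is FACT 0 of the SPLIT memos:
`A = #{red av|bc, blue a|b|c|v}`, `B = #{red av|b|c, blue a|v|bc}`. [new] -/
theorem sum_pref_mul_pref_eq_two_mul (𝒩 𝒜 ℬ : Finset (Finset ι)) (h𝒩 : ∀ X : Finset ι, Xᶜ ∈ 𝒩 ↔ X ∈ 𝒩) :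
    ∑ X : Finset ι, (if X ∈ 𝒩 then (1 : ℤ) else 0) *
        ((if X ∈ 𝒜 then (1 : ℤ) else 0) - (if Xᶜ ∈ 𝒜 then (1 : ℤ) else 0)) *
        ((if X ∈ ℬ then (1 : ℤ) else 0) - (if Xᶜ ∈ ℬ then (1 : ℤ) else 0)) =
      2 * (((𝒩.filter (fun X => X ∈ 𝒜 ∧ X ∈ ℬ ∧ Xᶜ ∉ 𝒜 ∧ Xᶜ ∉ ℬ)).card : ℤ) -
        ((𝒩.filter (fun X => X ∈ 𝒜 ∧ Xᶜ ∈ ℬ ∧ Xᶜ ∉ 𝒜 ∧ X ∉ ℬ)).card : ℤ)) := by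
  -- abbreviations for the integrand pieces
  set E : Finset ι → ℤ := fun X =>
    (if X ∈ 𝒜 then (1 : ℤ) else 0) * (if X ∈ ℬ then (1 : ℤ) else 0) *
        (1 - (if Xᶜ ∈ 𝒜 then (1 : ℤ) else 0)) * (1 - (if Xᶜ ∈ ℬ then (1 : ℤ) else 0)) -
      (if X ∈ 𝒜 then (1 : ℤ) else 0) * (if Xᶜ ∈ ℬ then (1 : ℤ) else 0) *
        (1 - (if Xᶜ ∈ 𝒜 then (1 : ℤ) else 0)) * (1 - (if X ∈ ℬ then (1 : ℤ) else 0)) with hE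
  -- pointwise: integrand = 1_𝒩 (E X + E Xᶜ)
  have hpt : ∀ X : Finset ι,
      (if X ∈ 𝒩 then (1 : ℤ) else 0) *
          ((if X ∈ 𝒜 then (1 : ℤ) else 0) - (if Xᶜ ∈ 𝒜 then (1 : ℤ) else 0)) *
          ((if X ∈ ℬ then (1 : ℤ) else 0) - (if Xᶜ ∈ ℬ then (1 : ℤ) else 0)) =
        (if X ∈ 𝒩 then (1 : ℤ) else 0) * E X + (if X ∈ 𝒩 then (1 : ℤ) else 0) * E Xᶜ := by
    intro X
    have h := pref_mul_pref_pointwise _ _ _ _ (ind_mem_eq 𝒜 X) (ind_mem_eq 𝒜 Xᶜ) (ind_mem_eq ℬ X)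
      (ind_mem_eq ℬ Xᶜ)
    simp only [hE, compl_compl]
    rw [mul_assoc, h]
    ring
  rw [Finset.sum_congr rfl fun X _ => hpt X, Finset.sum_add_distrib]
  -- re-index the second sum by the antipodal map
  have hσ : ∑ X : Finset ι, (if X ∈ 𝒩 then (1 : ℤ) else 0) * E Xᶜ =
      ∑ X : Finset ι, (if X ∈ 𝒩 then (1 : ℤ) else 0) * E X := by
    have := sum_comp_compl (fun X : Finset ι => (if X ∈ 𝒩 then (1 : ℤ) else 0) * E X)
    rw [← this]
    refine Finset.sum_congr rfl fun X _ => ?_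
    simp only [h𝒩 X]
  rw [hσ, ← two_mul]
  congr 1
  -- split E into its two indicator products and count
  have hA := sum_ind_prod_eq_card 𝒩 𝒜 ℬ (AntipodalHarris.antipode 𝒜) (AntipodalHarris.antipode ℬ)
  have hB := sum_ind_prod_eq_card 𝒩 𝒜 (AntipodalHarris.antipode ℬ) (AntipodalHarris.antipode 𝒜) ℬ
  simp only [AntipodalHarris.mem_antipode] at hA hB
  rw [← hA, ← hB, ← Finset.sum_sub_distrib]
  refine Finset.sum_congr rfl fun X _ => ?_
  simp only [hE]
  ring

/-- **Equivalence of the two forms of T2** on a fixed graph/interval: the correlation sum is `≤ 0` iff `A ≤ B`.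
[new] -/
theorem sum_pref_mul_pref_nonpos_iff (𝒩 𝒜 ℬ : Finset (Finset ι)) (h𝒩 : ∀ X : Finset ι, Xᶜ ∈ 𝒩 ↔ X ∈ 𝒩) :
    ∑ X : Finset ι, (if X ∈ 𝒩 then (1 : ℤ) else 0) *
        ((if X ∈ 𝒜 then (1 : ℤ) else 0) - (if Xᶜ ∈ 𝒜 then (1 : ℤ) else 0)) *
        ((if X ∈ ℬ then (1 : ℤ) else 0) - (if Xᶜ ∈ ℬ then (1 : ℤ) else 0)) ≤ 0 ↔
      (𝒩.filter (fun X => X ∈ 𝒜 ∧ X ∈ ℬ ∧ Xᶜ ∉ 𝒜 ∧ Xᶜ ∉ ℬ)).card ≤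
        (𝒩.filter (fun X => X ∈ 𝒜 ∧ Xᶜ ∈ ℬ ∧ Xᶜ ∉ 𝒜 ∧ X ∉ ℬ)).card := by
  rw [sum_pref_mul_pref_eq_two_mul 𝒩 𝒜 ℬ h𝒩]
  constructor
  · intro h
    exact_mod_cast (show ((𝒩.filter (fun X => X ∈ 𝒜 ∧ X ∈ ℬ ∧ Xᶜ ∉ 𝒜 ∧ Xᶜ ∉ ℬ)).card : ℤ) ≤
        ((𝒩.filter (fun X => X ∈ 𝒜 ∧ Xᶜ ∈ ℬ ∧ Xᶜ ∉ 𝒜 ∧ X ∉ ℬ)).card : ℤ) by linarith)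
  · intro h
    have : ((𝒩.filter (fun X => X ∈ 𝒜 ∧ X ∈ ℬ ∧ Xᶜ ∉ 𝒜 ∧ Xᶜ ∉ ℬ)).card : ℤ) ≤
        ((𝒩.filter (fun X => X ∈ 𝒜 ∧ Xᶜ ∈ ℬ ∧ Xᶜ ∉ 𝒜 ∧ X ∉ ℬ)).card : ℤ) := by exact_mod_cast h
    linarith

end AntipodalSplitForms

end Summit.CriticalPhenomena.PercolationContinuityZ3.Theorems
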